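import Summits.NavierStokesRegularity.FunctionalMining.NoGo.LogThresholdProfiles
import HarnessLib

/-!
# The log-door threshold witness: the quantitative package at `R = 4·2ⁿ`, `K = R⁶`

Search for candidate a priori estimates; no regularity claim. NS FUNCTIONAL MINING — NO-GO BRANCH
(cell `pub-nsfunc`, prove seat gen 4). `logThreshold_package`: there are constants
`M, J = ∫η³, e = ∫η², x₀ > 0`, `κ ≥ 0` and `n₀` such that for every `n ≥ n₀` one of the two N6
witnesses `U = G_n ± W_K` (`r = 1/R`, `R = 4·2ⁿ`, `K = R⁶`) is a smooth divergence-free field on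
`ℝ³` supported in `B̄(0,2)` with
`|ω_U|² ≤ M²`,  `X := (Sq a_r 0)(Sq g_K 3) ≥ x₀`,  `n J X ≤ 2 N(U)` (`N(U) = −∫⟪DU(U), Δ²U⟫`),
`∫‖ΔU‖² ≤ 4 e X`,  `∫Σᵢ‖∂ᵢΔU‖² ≤ κ 2^{32n}`.
So the Euclidean GAIN `N(U)/(M ∫‖ΔU‖²) ≥ n J/(8 M e)` grows linearly in `n` while every Sobolev
size grows at most exponentially in `n` — the input of the log-door threshold
(`NoGo/PalinstrophyLogThresholdWeak.lean`). Folklore calculus; nothing is asserted about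
Navier–Stokes.
-/

noncomputable section

open MeasureTheory Set Function Filter Real
open scoped ContDiff Topology Laplacian InnerProductSpace RealInnerProductSpace

namespace Summit.NavierStokesRegularity.FunctionalMining

namespace Sep3

open Literature.Analysis.FunctionSpaces Literature.Analysis.FluidPDE LogDoor

/-- `∞ ≠ 0` in `WithTop ℕ∞`. [folklore] -/
private theorem infty_ne_zero₁₃ : (∞ : WithTop ℕ∞) ≠ 0 := by simp

set_option maxHeartbeats 400000 in
/-- **The quantitative package of the log-door threshold witness.** [folklore] -/
theorem logThreshold_package : ∃ (M Jc e0 x0 κ : ℝ) (n₀ : ℕ), 0 < M ∧ 0 < Jc ∧ 0 < e0 ∧ 0 < x0 ∧ 0 ≤ κ ∧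
    ∀ n : ℕ, n₀ ≤ n → ∃ (U : E3 → E3) (X : ℝ),
      ContDiff ℝ ∞ U ∧ tsupport U ⊆ Metric.closedBall 0 2 ∧
      (∀ y, LinearMap.trace ℝ E3 (fderiv ℝ U y : E3 →ₗ[ℝ] E3) = 0) ∧
      (∀ y, eVortSq U y ≤ M ^ 2) ∧ x0 ≤ X ∧
      (n : ℝ) * Jc * X ≤ 2 * (-(∫ y, ⟪fderiv ℝ U y (U y), Δ (Δ U) y⟫)) ∧
      (∫ y, ‖Δ U y‖ ^ 2) ≤ 4 * e0 * X ∧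
      (∫ y, ∑ i : Fin 3, ‖fderiv ℝ (Δ U) y (EuclideanSpace.single i 1)‖ ^ 2) ≤ κ * 2 ^ (32 * n) := by
  -- (1) `n`-independent constants (all named constants are OPAQUE: `obtain`, not `set`)
  obtain ⟨B₁, hB₁, hb1⟩ := exists_bound_iteratedDeriv_stepB 1
  obtain ⟨B₂, hB₂, hb2⟩ := exists_bound_iteratedDeriv_stepB 2
  obtain ⟨E₁, hE₁, hE1⟩ := exists_bound_iteratedDeriv etaZ_contDiff etaZ_zero 1
  obtain ⟨E₂, hE₂, hE2⟩ := exists_bound_iteratedDeriv etaZ_contDiff etaZ_zero 2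
  obtain ⟨E₃, hE₃, hE3⟩ := exists_bound_iteratedDeriv etaZ_contDiff etaZ_zero 3
  obtain ⟨A₁', hA₁, hA1⟩ := exists_bound_iteratedDeriv bumpA.contDiff bumpA.zero 1
  obtain ⟨A₂', hA₂, hA2⟩ := exists_bound_iteratedDeriv bumpA.contDiff bumpA.zero 2
  obtain ⟨A₃', hA₃, hA3⟩ := exists_bound_iteratedDeriv bumpA.contDiff bumpA.zero 3
  obtain ⟨A₄', hA₄, hA4⟩ := exists_bound_iteratedDeriv bumpA.contDiff bumpA.zero 4
  obtain ⟨κP, hκP, hPG⟩ := background_laplacianNormSq_le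
  obtain ⟨κD, hκD, hDG⟩ := background_gradLaplacianNormSq_le
  obtain ⟨κN, hκN, hNG⟩ := background_production2_abs_le
  obtain ⟨Msq, hMsq⟩ : ∃ m : ℝ, m = ((24 * B₁ + 32 * B₂) * 1 + 2) ^ 2 + ((2 + 8 * B₁) * E₁ + 1) ^ 2 +
    ((2 + 8 * B₁) * E₁ + 1) ^ 2 := ⟨_, rfl⟩
  have hMsq1 : 1 ≤ Msq := by
    have h0 : 1 ≤ (2 + 8 * B₁) * E₁ + 1 := by
      have := mul_nonneg (by positivity : (0 : ℝ) ≤ 2 + 8 * B₁) hE₁; linarith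
    have h1 : 1 ≤ ((2 + 8 * B₁) * E₁ + 1) ^ 2 := one_le_pow₀ h0
    have h2 := sq_nonneg ((24 * B₁ + 32 * B₂) * 1 + 2)
    rw [hMsq]; linarith
  obtain ⟨M, hM0, hM2⟩ : ∃ M : ℝ, 0 < M ∧ M ^ 2 = Msq :=
    ⟨Real.sqrt Msq, Real.sqrt_pos.2 (by linarith), Real.sq_sqrt (by linarith)⟩
  obtain ⟨Jc, hJcdef⟩ : ∃ x : ℝ, x = J etaZ (0, 0, 0) := ⟨_, rfl⟩
  have hJc : 0 < Jc := by rw [hJcdef]; exact J_etaZ_pos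
  obtain ⟨e0, he0def⟩ : ∃ x : ℝ, x = Sq etaZ 0 := ⟨_, rfl⟩
  have he0 : 0 < e0 := by rw [he0def]; exact Sq_etaZ_zero_pos
  obtain ⟨e1, he1def⟩ : ∃ x : ℝ, x = Sq etaZ 1 := ⟨_, rfl⟩
  obtain ⟨e2, he2def⟩ : ∃ x : ℝ, x = Sq etaZ 2 := ⟨_, rfl⟩
  have he1 : 0 ≤ e1 := by rw [he1def]; exact Sq_nonneg _ _
  have he2 : 0 ≤ e2 := by rw [he2def]; exact Sq_nonneg _ _
  obtain ⟨α₀, hα₀def⟩ : ∃ x : ℝ, x = Sq bumpA 0 := ⟨_, rfl⟩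
  have hα₀ : 0 < α₀ := by rw [hα₀def]; exact Sq_bumpA_zero_pos
  obtain ⟨𝔞, h𝔞⟩ : ∃ x : ℝ, x = α₀ + 4 * (A₁' ^ 2 + A₂' ^ 2 + A₃' ^ 2) := ⟨_, rfl⟩
  obtain ⟨𝔤, h𝔤⟩ : ∃ x : ℝ, x = 4 * (2 + 2 * A₁' + A₂') ^ 2 := ⟨_, rfl⟩
  have h𝔞0 : 0 ≤ 𝔞 := by rw [h𝔞]; positivity
  have h𝔤0 : 0 ≤ 𝔤 := by rw [h𝔤]; positivity
  obtain ⟨c₃, hc₃⟩ : ∃ x : ℝ, x = A₃' + 3 * A₁' + 3 * A₂' := ⟨_, rfl⟩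
  obtain ⟨cK, hcK⟩ : ∃ x : ℝ, x = 1 + 2 * A₁' + 2 * A₂' + (A₁' + 1) * E₁ + A₁' * E₁ := ⟨_, rfl⟩
  obtain ⟨c𝒜, hc𝒜⟩ : ∃ x : ℝ, x = 1 + A₁' + A₂' + A₃' + A₄' := ⟨_, rfl⟩
  obtain ⟨cΓ, hcΓ⟩ : ∃ x : ℝ, x = 1 + 15 * c𝒜 := ⟨_, rfl⟩
  obtain ⟨ℰ, hℰ⟩ : ∃ x : ℝ, x = 1 + E₁ + E₂ + E₃ := ⟨_, rfl⟩
  obtain ⟨κ, hκ⟩ : ∃ x : ℝ, x = 2 * κD + 972 * (c𝒜 * cΓ * ℰ) ^ 2 * volBall 4 * 4 ^ 32 := ⟨_, rfl⟩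
  have hκ0 : 0 ≤ κ := by have := volBall_nonneg 4; rw [hκ]; positivity
  -- thresholds on `R`
  obtain ⟨T₁, hT₁⟩ : ∃ x : ℝ, x = 16 * κN / (Jc * α₀) + 1 := ⟨_, rfl⟩
  obtain ⟨T₂, hT₂⟩ : ∃ x : ℝ, x = 32 * 𝔞 * 𝔤 / α₀ + 1 := ⟨_, rfl⟩
  obtain ⟨T₃, hT₃⟩ : ∃ x : ℝ, x = 4 * (κP + (7 * e0 + 8 * e1 + 2 * e2) * 𝔞 * 𝔤) / (e0 * α₀) + 1 := ⟨_, rfl⟩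
  obtain ⟨Rmin, hRmin⟩ : ∃ x : ℝ, x = cK + (2 + 16 * c₃ ^ 2) + T₁ + T₂ + T₃ + 1 := ⟨_, rfl⟩
  have hT₁0 : 0 ≤ T₁ := by rw [hT₁]; positivity
  have hT₂0 : 0 ≤ T₂ := by rw [hT₂]; positivity
  have hT₃0 : 0 ≤ T₃ := by rw [hT₃]; positivity
  have hcK0 : 0 ≤ cK := by rw [hcK]; positivity
  have hc3sq : 0 ≤ c₃ ^ 2 := sq_nonneg _
  have hRmin1 : 1 ≤ Rmin := by rw [hRmin]; linarith
  refine ⟨M, Jc, e0, α₀ / 4, κ, ⌈Rmin⌉₊, hM0, hJc, he0, by positivity, hκ0, fun n hn => ?_⟩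
  -- (2) the scale `R = 4·2ⁿ`, `r = 1/R`, `K = R⁶`
  obtain ⟨h64, h256R, h256, hR32, hnR, hR4⟩ := scale_facts n
  obtain ⟨R, hRdef⟩ : ∃ x : ℝ, x = 4 * 2 ^ n := ⟨_, rfl⟩
  rw [← hRdef] at h64 h256R hR32 hnR hR4
  have hRminR : Rmin ≤ R := by
    have h1 : Rmin ≤ ⌈Rmin⌉₊ := Nat.le_ceil _
    have h2 : (⌈Rmin⌉₊ : ℝ) ≤ n := by exact_mod_cast hn
    linarith
  have hR1 : 1 ≤ R := by linarith
  have hR0 : 0 < R := by linarith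
  have hn1 : (1 : ℝ) ≤ n := by
    have h2 : (⌈Rmin⌉₊ : ℝ) ≤ n := by exact_mod_cast hn
    have h3 : Rmin ≤ ⌈Rmin⌉₊ := Nat.le_ceil _
    linarith
  have hcKR : cK ≤ R := by linarith
  have hc3R : 2 + 16 * (A₃' + 3 * A₁' + 3 * A₂') ^ 2 ≤ R := by rw [← hc₃]; linarith
  have hT1R : T₁ ≤ R := by linarith
  have hT2R : T₂ ≤ R := by linarith
  have hT3R : T₃ ≤ R := by linarith
  have hr0 : 0 < 1 / R := by positivity
  have hr4 : 1 / R ≤ 1 / 4 := one_div_le_one_div_of_le (by norm_num) hR4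
  have hr1 : 1 / R ≤ 1 := by linarith
  have hcore : (4 : ℝ) ^ n * (8 * (1 / R) ^ 2) < 2 := by
    have h4 : (4 : ℝ) ^ n = (2 ^ n) ^ 2 := by rw [← pow_mul, mul_comm, pow_mul]; norm_num
    have h2n : (0 : ℝ) < 2 ^ n := by positivity
    have e : (4 : ℝ) ^ n * (8 * (1 / R) ^ 2) = 1 / 2 := by
      rw [hRdef, h4]; field_simp; ring
    rw [e]; norm_num
  have hK1 : (1 : ℝ) ≤ R ^ 6 := one_le_pow₀ hR1
  -- profile data at this scale
  have haA1 : ∀ t, |iteratedDeriv 1 (bumpR (1 / R)) t| ≤ A₁' * R := fun t => by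
    simpa using abs_iteratedDeriv_bumpR_le_R hR0 hA1 t
  have haA2 : ∀ t, |iteratedDeriv 2 (bumpR (1 / R)) t| ≤ A₂' * R ^ 2 := fun t =>
    abs_iteratedDeriv_bumpR_le_R hR0 hA2 t
  have hKK := vorticity_threshold_scale hR1 hA₁ hA₂ hE₁ (by rw [← hcK]; exact hcKR)
  -- vorticity (uniform in `n`)
  have hvort := fun y => witness_vorticity n hB₁ hB₂ hb1 hb2 hE1 (by positivity) haA1 haA2 hK1 hKK y
  -- the `Sq` sizes (opaque names)
  obtain ⟨a0, ha0def⟩ : ∃ x : ℝ, x = Sq (bumpR (1 / R)) 0 := ⟨_, rfl⟩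
  obtain ⟨a1, ha1def⟩ : ∃ x : ℝ, x = Sq (bumpR (1 / R)) 1 := ⟨_, rfl⟩
  obtain ⟨a2, ha2def⟩ : ∃ x : ℝ, x = Sq (bumpR (1 / R)) 2 := ⟨_, rfl⟩
  obtain ⟨a3, ha3def⟩ : ∃ x : ℝ, x = Sq (bumpR (1 / R)) 3 := ⟨_, rfl⟩
  obtain ⟨g0, hg0def⟩ : ∃ x : ℝ, x = Sq (gK (bumpR (1 / R)) (R ^ 6)) 0 := ⟨_, rfl⟩
  obtain ⟨g1, hg1def⟩ : ∃ x : ℝ, x = Sq (gK (bumpR (1 / R)) (R ^ 6)) 1 := ⟨_, rfl⟩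
  obtain ⟨g2, hg2def⟩ : ∃ x : ℝ, x = Sq (gK (bumpR (1 / R)) (R ^ 6)) 2 := ⟨_, rfl⟩
  obtain ⟨g3, hg3def⟩ : ∃ x : ℝ, x = Sq (gK (bumpR (1 / R)) (R ^ 6)) 3 := ⟨_, rfl⟩
  have ha0n : 0 ≤ a0 := by rw [ha0def]; exact Sq_nonneg _ _
  have ha1n : 0 ≤ a1 := by rw [ha1def]; exact Sq_nonneg _ _
  have ha2n : 0 ≤ a2 := by rw [ha2def]; exact Sq_nonneg _ _
  have ha3n : 0 ≤ a3 := by rw [ha3def]; exact Sq_nonneg _ _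
  have hg0n : 0 ≤ g0 := by rw [hg0def]; exact Sq_nonneg _ _
  have hg1n : 0 ≤ g1 := by rw [hg1def]; exact Sq_nonneg _ _
  have hg2n : 0 ≤ g2 := by rw [hg2def]; exact Sq_nonneg _ _
  have hg3n : 0 ≤ g3 := by rw [hg3def]; exact Sq_nonneg _ _
  have a0eq : a0 = 1 / R * α₀ := by rw [ha0def, hα₀def]; exact Sq_bumpR_zero hr0
  have h𝔞1 : 4 * A₁' ^ 2 ≤ 𝔞 := by rw [h𝔞]; linarith [sq_nonneg A₂', sq_nonneg A₃', hα₀.le]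
  have h𝔞2 : 4 * A₂' ^ 2 ≤ 𝔞 := by rw [h𝔞]; linarith [sq_nonneg A₁', sq_nonneg A₃', hα₀.le]
  have h𝔞3 : 4 * A₃' ^ 2 ≤ 𝔞 := by rw [h𝔞]; linarith [sq_nonneg A₁', sq_nonneg A₂', hα₀.le]
  have h𝔞α : α₀ ≤ 𝔞 := by rw [h𝔞]; linarith [sq_nonneg A₁', sq_nonneg A₂', sq_nonneg A₃']
  have a1le : a1 ≤ 𝔞 * R ^ 2 := by
    rw [ha1def]; refine (Sq_bumpR_le hR1 hA1).trans ?_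
    rw [show 4 * (A₁' * R ^ 1) ^ 2 = (4 * A₁' ^ 2) * R ^ 2 by ring]
    exact mul_le_mul_of_nonneg_right h𝔞1 (by positivity)
  have a2le : a2 ≤ 𝔞 * R ^ 4 := by
    rw [ha2def]; refine (Sq_bumpR_le hR1 hA2).trans ?_
    rw [show 4 * (A₂' * R ^ 2) ^ 2 = (4 * A₂' ^ 2) * R ^ 4 by ring]
    exact mul_le_mul_of_nonneg_right h𝔞2 (by positivity)
  have a3le : a3 ≤ 𝔞 * R ^ 6 := by
    rw [ha3def]; refine (Sq_bumpR_le hR1 hA3).trans ?_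
    rw [show 4 * (A₃' * R ^ 3) ^ 2 = (4 * A₃' ^ 2) * R ^ 6 by ring]
    exact mul_le_mul_of_nonneg_right h𝔞3 (by positivity)
  have a0le : a0 ≤ 𝔞 * R ^ 0 := by
    rw [a0eq, pow_zero, mul_one]
    have : 1 / R * α₀ ≤ 1 * α₀ := mul_le_mul_of_nonneg_right (by rw [div_le_one hR0]; exact hR1) hα₀.le
    linarith
  have g0le : g0 ≤ 𝔤 * R ^ 0 := by
    rw [hg0def, h𝔤]; simpa using Sq_gK_le_R hR1 hA1 hA2 (m := 0) (by norm_num)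
  have g1le : g1 ≤ 𝔤 * R ^ 2 := by
    rw [hg1def, h𝔤]; simpa using Sq_gK_le_R hR1 hA1 hA2 (m := 1) (by norm_num)
  have g2le : g2 ≤ 𝔤 * R ^ 4 := by
    rw [hg2def, h𝔤]; simpa using Sq_gK_le_R hR1 hA1 hA2 (m := 2) (by norm_num)
  have g3ge : R ^ 11 / 4 ≤ g3 := by rw [hg3def]; exact Sq_gK_three_ge_R hR1 hA1 hA2 hA3 hc3R
  obtain ⟨X, hX⟩ : ∃ x : ℝ, x = a0 * g3 := ⟨_, rfl⟩
  -- `X ≥ α₀ R¹⁰ / 4 ≥ α₀ / 4`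
  have hXge : α₀ * R ^ 10 / 4 ≤ X := by
    rw [hX, a0eq]
    have : 1 / R * α₀ * (R ^ 11 / 4) = α₀ * R ^ 10 / 4 := by field_simp
    rw [← this]
    exact mul_le_mul_of_nonneg_left g3ge (by positivity)
  have hR10 : (1 : ℝ) ≤ R ^ 10 := one_le_pow₀ hR1
  have hXx0 : α₀ / 4 ≤ X :=
    le_trans (div_le_div_of_nonneg_right (le_mul_of_one_le_right hα₀.le hR10) (by norm_num)) hXge
  -- the eight cross products are `≤ 𝔞 𝔤 R⁶`
  have p12 := mul_le_scale hR1 ha1n hg2n h𝔞0 h𝔤0 a1le g2le (by norm_num)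
  have p21 := mul_le_scale hR1 ha2n hg1n h𝔞0 h𝔤0 a2le g1le (by norm_num)
  have p30 := mul_le_scale hR1 ha3n hg0n h𝔞0 h𝔤0 a3le g0le (by norm_num)
  have p02 := mul_le_scale hR1 ha0n hg2n h𝔞0 h𝔤0 a0le g2le (by norm_num)
  have p11 := mul_le_scale hR1 ha1n hg1n h𝔞0 h𝔤0 a1le g1le (by norm_num)
  have p20 := mul_le_scale hR1 ha2n hg0n h𝔞0 h𝔤0 a2le g0le (by norm_num)
  have p01 := mul_le_scale hR1 ha0n hg1n h𝔞0 h𝔤0 a0le g1le (by norm_num)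
  have p10 := mul_le_scale hR1 ha1n hg0n h𝔞0 h𝔤0 a1le g0le (by norm_num)
  have hR4' : R ≤ R ^ 4 := le_self_pow₀ hR1 (by norm_num)
  -- junk-N: `κN 256ⁿ + n Jc (a2 g1 + a3 g0) ≤ n Jc X / 2`
  have i1 : 16 * κN ≤ Jc * α₀ * R ^ 2 := by
    have hpos : 0 < Jc * α₀ := mul_pos hJc hα₀
    have hR2 : R ≤ R ^ 2 := le_self_pow₀ hR1 two_ne_zero
    have : 16 * κN / (Jc * α₀) ≤ R ^ 2 := by linarith
    have h' := (div_le_iff₀ hpos).1 this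
    linarith
  have i2 : 32 * 𝔞 * 𝔤 ≤ α₀ * R ^ 4 := by
    have : 32 * 𝔞 * 𝔤 / α₀ ≤ R ^ 4 := by linarith
    have h' := (div_le_iff₀ hα₀).1 this
    linarith
  have junkN := junk_production_le (s := a2 * g1 + a3 * g0) hn1 hJc hα₀ hκN h256R i1 i2
    (by linarith) hXge
  -- junk-P: `κP 64ⁿ + (PW − e0 X) ≤ e0 X`
  have i3 : 4 * (κP + (7 * e0 + 8 * e1 + 2 * e2) * 𝔞 * 𝔤) ≤ e0 * α₀ * R ^ 4 := by
    have hpos : 0 < e0 * α₀ := mul_pos he0 hα₀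
    have : 4 * (κP + (7 * e0 + 8 * e1 + 2 * e2) * 𝔞 * 𝔤) / (e0 * α₀) ≤ R ^ 4 := by linarith
    have h' := (div_le_iff₀ hpos).1 this
    linarith
  have hsum : e0 * (3 * (a1 * g2) + 3 * (a2 * g1) + a3 * g0) +
      2 * e1 * (a0 * g2 + 2 * (a1 * g1) + a2 * g0) + e2 * (a0 * g1 + a1 * g0) ≤
      ((7 * e0 + 8 * e1 + 2 * e2) * 𝔞 * 𝔤) * R ^ 6 := by
    have q1 := mul_le_mul_of_nonneg_left p12 he0.le
    have q2 := mul_le_mul_of_nonneg_left p21 he0.le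
    have q3 := mul_le_mul_of_nonneg_left p30 he0.le
    have q4 := mul_le_mul_of_nonneg_left p02 he1
    have q5 := mul_le_mul_of_nonneg_left p11 he1
    have q6 := mul_le_mul_of_nonneg_left p20 he1
    have q7 := mul_le_mul_of_nonneg_left p01 he2
    have q8 := mul_le_mul_of_nonneg_left p10 he2
    linarith
  have junkP := junk_palinstrophy_le he0 hκP h64 i3 hsum hXge
  -- (3) the two witnesses and the three budgets
  set G : E3 → E3 := background n etaZ with hGdef
  set W : E3 → E3 := packet (prof (1 / R) (R ^ 6)) with hWdef
  have hφ : ∀ i, ContDiff ℝ ∞ (prof (1 / R) (R ^ 6) i) := prof_contDiff _ _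
  have hφ0 : ∀ i t, 2 < |t| → prof (1 / R) (R ^ 6) i t = 0 := prof_eq_zero hr0 hr1 _
  have hGs : ContDiff ℝ ∞ G := contDiff_background etaZ_contDiff
  have hWs : ContDiff ℝ ∞ W := contDiff_packet hφ
  have hGd : Differentiable ℝ G := hGs.differentiable infty_ne_zero₁₃
  have hWd : Differentiable ℝ W := hWs.differentiable infty_ne_zero₁₃
  have hts : ∀ t s : ℝ, tsupport (fun y => t • G y + s • W y) ⊆ Metric.closedBall 0 2 :=
    fun t s => tsupport_subset hr0 hr4 (R ^ 6) n t s
  have hUp_ts : tsupport (fun y => G y + W y) ⊆ Metric.closedBall 0 2 := by simpa [one_smul] using hts 1 1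
  have hUm_ts : tsupport (fun y => G y - W y) ⊆ Metric.closedBall 0 2 := by
    simpa [one_smul, sub_eq_add_neg] using hts 1 (-1)
  have hG_ts : tsupport G ⊆ Metric.closedBall 0 2 := by simpa using hts 1 0
  have hW_ts : tsupport W ⊆ Metric.closedBall 0 2 := by simpa using hts 0 1
  have hGc : HasCompactSupport G :=
    HasCompactSupport.of_support_subset_isCompact (isCompact_closedBall 0 2) (subset_closure.trans hG_ts)
  have hWc : HasCompactSupport W :=
    HasCompactSupport.of_support_subset_isCompact (isCompact_closedBall 0 2) (subset_closure.trans hW_ts)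
  have hGtr : ∀ y, LinearMap.trace ℝ E3 (fderiv ℝ G y : E3 →ₗ[ℝ] E3) = 0 := background_trace etaZ_contDiff
  have hWtr : ∀ y, LinearMap.trace ℝ E3 (fderiv ℝ W y : E3 →ₗ[ℝ] E3) = 0 := packet_trace hφ
  have hUp_tr : ∀ y, LinearMap.trace ℝ E3 (fderiv ℝ (fun z => G z + W z) y : E3 →ₗ[ℝ] E3) = 0 := by
    intro y
    rw [fderiv_fun_add (hGd y) (hWd y), ContinuousLinearMap.toLinearMap_add, map_add, hGtr y, hWtr y, add_zero]
  have hUm_tr : ∀ y, LinearMap.trace ℝ E3 (fderiv ℝ (fun z => G z - W z) y : E3 →ₗ[ℝ] E3) = 0 := by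
    intro y
    rw [fderiv_fun_sub (hGd y) (hWd y), ContinuousLinearMap.toLinearMap_sub, map_sub, hGtr y, hWtr y, sub_zero]
  -- production
  have hprod := production_add_sub_eq n (K := R ^ 6) hr0 hr4 hcore
  rw [← ha0def, ← ha1def, ← ha2def, ← ha3def, ← hg0def, ← hg1def, ← hg2def, ← hg3def, ← hJcdef] at hprod
  have hNGn := hNG n
  have hNsum : (n : ℝ) * Jc * X ≤
      (-(∫ y, ⟪fderiv ℝ (fun z => G z + W z) y (G y + W y), Δ (Δ (fun z => G z + W z)) y⟫)) +
      (-(∫ y, ⟪fderiv ℝ (fun z => G z - W z) y (G y - W y), Δ (Δ (fun z => G z - W z)) y⟫)) := by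
    rw [hGdef, hWdef, hprod]
    have hP2 := abs_le.mp hNGn
    have hnJ : 0 ≤ (n : ℝ) * Jc := by positivity
    have hpos := mul_nonneg hnJ (mul_nonneg ha1n hg2n)
    have hX' : (n : ℝ) * Jc * X = (n : ℝ) * Jc * (a0 * g3) := by rw [hX]
    linarith only [hP2.1, hP2.2, hX', hpos, junkN]
  -- palinstrophy
  have hpal := laplacianNormSq_add_sub_eq n (K := R ^ 6) hr0 hr4
  rw [← ha0def, ← ha1def, ← ha2def, ← ha3def, ← hg0def, ← hg1def, ← hg2def, ← hg3def, ← he0def, ← he1def,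
    ← he2def] at hpal
  have hPGn := hPG n
  have hPp0 : 0 ≤ ∫ y, ‖Δ (fun z => G z + W z) y‖ ^ 2 := integral_nonneg fun _ => sq_nonneg _
  have hPm0 : 0 ≤ ∫ y, ‖Δ (fun z => G z - W z) y‖ ^ 2 := integral_nonneg fun _ => sq_nonneg _
  have hPsum : (∫ y, ‖Δ (fun z => G z + W z) y‖ ^ 2) + (∫ y, ‖Δ (fun z => G z - W z) y‖ ^ 2) ≤
      4 * e0 * X := by
    rw [hGdef, hWdef, hpal]
    have hX' : e0 * X = e0 * (a0 * g3) := by rw [hX]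
    linarith only [junkP, hX', hPGn]
  -- dissipation
  have hdis := gradLaplacianNormSq_add_sub_le hGs hWs hGc hWc
  have hDGn := hDG n
  have h𝒮 := abs_sep_prof_le hR1 hA1 hA2 hA3 hA4 hE1 hE2 hE3
  have hDW := packet_gradLaplacianNormSq_le hφ hφ0 fun i j k y hi hj hk => h𝒮 i j k y hi hj hk
  have hc𝒜1 : 1 ≤ c𝒜 := by rw [hc𝒜]; linarith only [hA₁, hA₂, hA₃, hA₄]
  have hc𝒜0 : 0 ≤ c𝒜 := zero_le_one.trans hc𝒜1
  have hcΓ0 : 0 ≤ cΓ := by rw [hcΓ]; positivity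
  have hℰ0 : 0 ≤ ℰ := by rw [hℰ]; positivity
  have hΓle : (R ^ 6) ^ 2 + 4 * R ^ 6 * ((1 + A₁' + A₂' + A₃' + A₄') * R ^ 4) +
      11 * ((1 + A₁' + A₂' + A₃' + A₄') * R ^ 4) ≤ cΓ * R ^ 12 := by
    have h10 : R ^ 10 ≤ R ^ 12 := pow_le_pow_right₀ hR1 (by norm_num)
    have h4'' : R ^ 4 ≤ R ^ 12 := pow_le_pow_right₀ hR1 (by norm_num)
    have e1 : (R ^ 6) ^ 2 = R ^ 12 := by ring
    have e2 : 4 * R ^ 6 * ((1 + A₁' + A₂' + A₃' + A₄') * R ^ 4) = 4 * c𝒜 * R ^ 10 := by rw [hc𝒜]; ring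
    have e3 : 11 * ((1 + A₁' + A₂' + A₃' + A₄') * R ^ 4) = 11 * c𝒜 * R ^ 4 := by rw [hc𝒜]; ring
    rw [e1, e2, e3, hcΓ]
    have q1 := mul_le_mul_of_nonneg_left h10 (by positivity : (0 : ℝ) ≤ 4 * c𝒜)
    have q2 := mul_le_mul_of_nonneg_left h4'' (by positivity : (0 : ℝ) ≤ 11 * c𝒜)
    linarith only [q1, q2]
  have h𝒮sq : (((1 + A₁' + A₂' + A₃' + A₄') * R ^ 4) *
      ((R ^ 6) ^ 2 + 4 * R ^ 6 * ((1 + A₁' + A₂' + A₃' + A₄') * R ^ 4) +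
        11 * ((1 + A₁' + A₂' + A₃' + A₄') * R ^ 4)) * (1 + E₁ + E₂ + E₃)) ^ 2 ≤
      (c𝒜 * cΓ * ℰ) ^ 2 * R ^ 32 := by
    have hle : ((1 + A₁' + A₂' + A₃' + A₄') * R ^ 4) *
        ((R ^ 6) ^ 2 + 4 * R ^ 6 * ((1 + A₁' + A₂' + A₃' + A₄') * R ^ 4) +
          11 * ((1 + A₁' + A₂' + A₃' + A₄') * R ^ 4)) * (1 + E₁ + E₂ + E₃) ≤
        (c𝒜 * cΓ * ℰ) * R ^ 16 := by
      have e : (c𝒜 * cΓ * ℰ) * R ^ 16 = (c𝒜 * R ^ 4) * (cΓ * R ^ 12) * ℰ := by ring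
      rw [e, hc𝒜, hℰ]
      rw [hc𝒜] at hc𝒜0
      exact mul_le_mul_of_nonneg_right (mul_le_mul_of_nonneg_left hΓle (by positivity)) (by positivity)
    calc _ ≤ ((c𝒜 * cΓ * ℰ) * R ^ 16) ^ 2 := pow_le_pow_left₀ (by positivity) hle 2
      _ = (c𝒜 * cΓ * ℰ) ^ 2 * R ^ 32 := by ring
  have hDtot : 2 * (∫ y, ∑ i : Fin 3, ‖fderiv ℝ (Δ G) y (EuclideanSpace.single i 1)‖ ^ 2) +
      2 * (∫ y, ∑ i : Fin 3, ‖fderiv ℝ (Δ W) y (EuclideanSpace.single i 1)‖ ^ 2) ≤ κ * 2 ^ (32 * n) := by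
    have hv4 := volBall_nonneg 4
    have h1 : (∫ y, ∑ i : Fin 3, ‖fderiv ℝ (Δ G) y (EuclideanSpace.single i 1)‖ ^ 2) ≤ κD * 2 ^ (32 * n) :=
      hDGn.trans (mul_le_mul_of_nonneg_left h256 hκD)
    have h2 : (∫ y, ∑ i : Fin 3, ‖fderiv ℝ (Δ W) y (EuclideanSpace.single i 1)‖ ^ 2) ≤
        486 * ((c𝒜 * cΓ * ℰ) ^ 2 * (4 ^ 32 * 2 ^ (32 * n))) * volBall 4 := by
      refine hDW.trans (mul_le_mul_of_nonneg_right (mul_le_mul_of_nonneg_left ?_ (by norm_num)) hv4)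
      rw [← hR32]; exact h𝒮sq
    rw [hκ]
    linarith only [h1, h2]
  -- (4) choose the sign
  rcases le_total
      (-(∫ y, ⟪fderiv ℝ (fun z => G z - W z) y (G y - W y), Δ (Δ (fun z => G z - W z)) y⟫))
      (-(∫ y, ⟪fderiv ℝ (fun z => G z + W z) y (G y + W y), Δ (Δ (fun z => G z + W z)) y⟫)) with hle | hle
  · refine ⟨fun z => G z + W z, X, hGs.add hWs, hUp_ts, hUp_tr, ?_, hXx0, ?_, ?_, ?_⟩
    · intro y; rw [hM2, hMsq]; exact (hvort y).1
    · linarith only [hNsum, hle]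
    · linarith only [hPsum, hPm0]
    · exact hdis.1.trans hDtot
  · refine ⟨fun z => G z - W z, X, hGs.sub hWs, hUm_ts, hUm_tr, ?_, hXx0, ?_, ?_, ?_⟩
    · intro y; rw [hM2, hMsq]; exact (hvort y).2
    · linarith only [hNsum, hle]
    · linarith only [hPsum, hPp0]
    · exact hdis.2.trans hDtot

end Sep3

end Summit.NavierStokesRegularity.FunctionalMining

end
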